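import Literature.AlgebraicGeometry.Frobenioids.ArithmeticFrobenioidModel
import Literature.AlgebraicGeometry.Frobenioids.ModelFrobenioidTypeBridge
import HarnessLib

/-!
# Frobenioids I, Theorem 6.4 (i): the arithmetic model Frobenioid `C_{K/F}` is of isotropic type — PROOF

Mochizuki, *The geometry of Frobenioids I*, Kyushu J. Math. **62** (2008), Thm. 6.4 (i), kurims p. 114: "the
Frobenioids `C`, … are of isotropic … type"; proof p. 115: "We have already seen in Example 6.3 that the
Frobenioid `C` is of isotropic … type" (i.e. Thm. 5.2 (ii) for the model Frobenioid `C_{K/F}`, whose rational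
function monoid `B : L ↦ L^×` is group-like). [cite: MochizukiFrdI2008, Thm. 6.4 (i) p.114]

PROVED here (seat abc-iut-L6-t10) for the CONSTRUCTED model (`ArithmeticFrobenioidModel.lean`), from
abc-iut-L1-t2's transfer of Thm. 5.2 (ii) to the operations `PreFrobenioidData.ofModel`
(`ModelFrobenioid.ofModel_isOfIsotropicType`): the only input is that each `B(Spec L) = L^×` is group-like
(`isGroupLike_of_commGroup`). This is the "isotropic" conjunct of abc-iut-L1-t3's `Thm64i_frobenioid` at
`M := arithModelFrobenioid F K`.
-/

noncomputable section

namespace Literature.AlgebraicGeometry.Frobenioids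

open CategoryTheory Opposite

/-- A commutative group, regarded as a monoid, is group-like in the sense of FrdI Def. 1.1 (i): integral,
saturated, units acting freely, and `M^char = 0`. [cite: MochizukiFrdI2008, Def. 1.1 (i) p.19] -/
theorem isGroupLike_of_commGroup (G : Type*) [CommGroup G] : IsGroupLike G where
  isPreDivisorial :=
    { isIntegral := ⟨Algebra.GrothendieckGroup.of_injective⟩
      isSaturated := ⟨fun x _ _ _ => by
        induction x using Localization.induction_on with
        | H y =>
          obtain ⟨m, s⟩ := y
          refine ⟨m * (s : G)⁻¹, ?_⟩
          rw [map_mul, map_inv, show Algebra.GrothendieckGroup.of m = Localization.mk m 1 from rfl,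
            show Algebra.GrothendieckGroup.of (s : G) = Localization.mk (s : G) 1 from rfl,
            ← div_eq_mul_inv, Algebra.GrothendieckGroup.mk_div_mk]
          congr 1
          · exact mul_one m
          · exact Subtype.ext (one_mul _)⟩
      isOfCharType := ⟨fun u a h => Units.ext (mul_right_cancel (h.trans (one_mul a).symm))⟩ }
  subsingleton_associates := ⟨fun x y => by
    obtain ⟨a, rfl⟩ := Associates.mk_surjective x
    obtain ⟨b, rfl⟩ := Associates.mk_surjective y
    exact Associates.mk_eq_mk_iff_associated.mpr ⟨⟨a⁻¹ * b, b⁻¹ * a, by group, by group⟩, by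
      show a * (a⁻¹ * b) = b
      group⟩⟩

variable (F : Type) [Field F] [NumberField F] (K : Type) [Field K] [Algebra F K]

omit [NumberField F] in
/-- The rational function monoid `B : Spec L ↦ L^×` of Example 6.3 is group-like.
[cite: MochizukiFrdI2008, Ex. 6.3 p.113] -/
theorem unitsFunctor_isGroupLike : Objectwise (fun M _ => IsGroupLike M) (unitsFunctor F K) :=
  fun X => isGroupLike_of_commGroup (X.L)ˣ

/-- **Theorem 6.4 (i), "`C` is of isotropic type"** — PROVED for the constructed arithmetic model Frobenioid
`C_{K/F}` (Thm. 5.2 (ii) via abc-iut-L1-t2's `ModelFrobenioid.ofModel_isOfIsotropicType`).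
[cite: MochizukiFrdI2008, Thm. 6.4 (i) p.114] -/
theorem isOfIsotropicType_arith : (arithFrobenioidOps F K).IsOfIsotropicType :=
  ModelFrobenioid.ofModel_isOfIsotropicType _ _ _ (unitsFunctor_isGroupLike F K)

end Literature.AlgebraicGeometry.Frobenioids

end
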